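import Literature.Analysis.FluidPDE.ForwardMildWeak
import Literature.Analysis.FluidPDE.CriticalSpaces
import Literature.Analysis.FunctionSpaces.GaussianSchwartz
import HarnessLib

/-!
# Bounded representatives of essentially bounded mild solutions

Analysis/FluidPDE support file (all results proved), second bridge in the plan of
`NSCriticalClosureBesovBounded.lean` for the smoothing fact
`Literature.Analysis.FluidPDE.knss_classical_of_bounded_isBesovMildSolutionOn` (Koch–Nadirashvili–
Seregin–Šverák 2009, §4). The hypotheses of that fact bound the slices of a Besov mild solution
only *essentially* (`eLpNorm (u t) ∞ volume ≤ C`), the solution being an a.e.-defined object,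
whereas KNSS's bounded weak solutions (`IsBoundedWeakNSSolutionOn`, `KNSSLiouville.lean`) and
the bridge `isBoundedWeakNSSolutionOn_of_isMildNSSolutionOn` (`ForwardMildWeak.lean`) are
phrased with a pointwise bound on the chosen representative. This file performs the harmless
change of representative:

* `IsDistributionOf.aestronglyMeasurable`: a field having a tempered distribution
  (`IsDistributionOf`, i.e. integrable against every Schwartz function) is a.e. strongly
  measurable (test against a Gaussian, which never vanishes);
* the radial retraction `v ↦ (M / max M ‖v‖) • v` onto the closed ball of radius `M > 0`
  (continuous, norm `≤ M`, the identity on the ball) and the retracted field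
  (`exists_bounded_representative`): if `‖u t‖_{L^∞} ≤ M` for `t ∈ [0, T)` then the retracted
  field `w` is bounded by `M` everywhere, `w t = u t` a.e. for every `t ∈ [0, T)`, and `w`
  inherits slice and joint measurability;
* invariance of the duality-form classes under a.e. modification of every slice
  (`IsMildNSSolutionOn.congr_ae_Ico`, with the tree's `IsWeaklyDivFree.congr_ae`: all clauses are
  integrals in `x` of the slices);
* the assembled bridge `exists_isBoundedWeakNSSolutionOn_of_isMildNSSolutionOn`: an unforced
  duality-form mild solution on `[0, T)` from its initial slice, with essentially bounded slices
  (uniformly on `[0, T)`), measurable slices and jointly measurable, agrees slice-wise a.e. with a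
  bounded weak solution on `ℝⁿ × (0, T)` in the sense of KNSS.

## References

* G. Koch, N. Nadirashvili, G. Seregin, V. Šverák, Acta Math. 203 (2009) 83–105 =
  arXiv:0709.3599, §3 p. 7 and §4 (i)–(ii) p. 8 ("a bounded measurable vector field";
  the class is one of `L^∞` functions, i.e. of a.e.-equivalence classes).
  [KochNadirashviliSereginSverak2009]
-/

noncomputable section

open MeasureTheory Set Function Filter TopologicalSpace InnerProductSpace
open _root_.Topology
open scoped RealInnerProductSpace NNReal ENNReal SchwartzMap

namespace Literature.Analysis.FluidPDE

/-! ### Measurability of a field that has a tempered distribution -/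

section Distribution

variable {ι : Type*} [Fintype ι] {E : Type*} [NormedAddCommGroup E] [InnerProductSpace ℝ E]
  [MeasureSpace E] [BorelSpace E]

/-- **A field with a tempered distribution is a.e. strongly measurable**: `IsDistributionOf u₀ U`
makes `θ • u₀` integrable for every Schwartz `θ`, in particular for the Gaussian
`θ = e^{-‖x‖²}`, which vanishes nowhere; dividing by it and undoing the (isometric)
complexification gives the measurability of `u₀`. [folklore] -/
theorem IsDistributionOf.aestronglyMeasurable {u₀ : E → EuclideanSpace ℝ ι}
    {U : 𝓢'(E, EuclideanSpace ℂ ι)} (h : IsDistributionOf u₀ U) :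
    AEStronglyMeasurable u₀ volume := by
  set θ : 𝓢(E, ℂ) := FunctionSpaces.gaussianSchwartz E 1 with hθ
  have hθx : ∀ x, θ x = ((Real.exp (-1 * ‖x‖ ^ 2) : ℝ) : ℂ) := fun x =>
    FunctionSpaces.gaussianSchwartz_apply one_pos x
  -- the reciprocal Gaussian, a continuous function
  set g : E → ℂ := fun x => ((Real.exp (1 * ‖x‖ ^ 2) : ℝ) : ℂ) with hg
  have hgc : Continuous g := by
    rw [hg]
    fun_prop
  have hgθ : ∀ x, g x * θ x = 1 := fun x => by
    rw [hθx, hg]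
    push_cast
    rw [← Complex.exp_add]
    convert Complex.exp_zero using 2
    ring
  have h1 : AEStronglyMeasurable (fun x => θ x • FunctionSpaces.EuclideanSpace.complexify (u₀ x))
      volume := (h θ).1.aestronglyMeasurable
  have h2 : AEStronglyMeasurable (fun x => g x • (θ x • FunctionSpaces.EuclideanSpace.complexify (u₀ x)))
      volume := hgc.aestronglyMeasurable.smul h1
  have h3 : AEStronglyMeasurable (fun x => FunctionSpaces.EuclideanSpace.complexify (u₀ x)) volume := by
    refine h2.congr (Eventually.of_forall fun x => ?_)
    simp only [smul_smul, hgθ x, one_smul]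
  exact (FunctionSpaces.EuclideanSpace.complexify (ι := ι)).isometry.isEmbedding.aestronglyMeasurable_comp_iff.1 h3

end Distribution

/-! ### The radial retraction onto a closed ball -/

section Retract

variable {F : Type*} [NormedAddCommGroup F] [NormedSpace ℝ F]

/-- The radial retraction `v ↦ (M / max M ‖v‖) • v` is continuous for `M > 0` (the scalar factor
is a continuous function of `‖v‖` with denominator `≥ M > 0`). [folklore] -/
theorem continuous_radialRetract {M : ℝ} (hM : 0 < M) :
    Continuous fun v : F => (M / max M ‖v‖) • v := by
  refine Continuous.smul ?_ continuous_id
  exact continuous_const.div (continuous_const.max continuous_norm)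
    fun v => (lt_of_lt_of_le hM (le_max_left _ _)).ne'

/-- The radial retraction has norm at most `M` (`M > 0`). [folklore] -/
theorem norm_radialRetract_le {M : ℝ} (hM : 0 < M) (v : F) : ‖(M / max M ‖v‖) • v‖ ≤ M := by
  have hmax : 0 < max M ‖v‖ := lt_of_lt_of_le hM (le_max_left _ _)
  rw [norm_smul, Real.norm_of_nonneg (div_nonneg hM.le hmax.le), div_mul_eq_mul_div,
    div_le_iff₀ hmax]
  exact mul_le_mul_of_nonneg_left (le_max_right _ _) hM.le

/-- The radial retraction is the identity on the closed ball of radius `M`. [folklore] -/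
theorem radialRetract_eq_self {M : ℝ} (hM : 0 < M) {v : F} (hv : ‖v‖ ≤ M) :
    (M / max M ‖v‖) • v = v := by
  rw [max_eq_left hv, div_self hM.ne', one_smul]

end Retract

/-! ### Invariance of the duality-form classes under a.e. modification of the slices -/

section Congr

variable {E : Type*} [NormedAddCommGroup E] [InnerProductSpace ℝ E] [FiniteDimensional ℝ E]
  [MeasurableSpace E] [BorelSpace E]

/-- **The duality-form mild class on `[0, T)` only sees the a.e. classes of the slices**: if
`w t = u t` a.e. for every `t ∈ [0, T)` and `w₀ = u₀` a.e., then `u` is an unforced mild solution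
on `[0, T)` from `u₀` iff `w` is one from `w₀` (every clause is an `x`-integral of a slice; the
time integral runs over `[0, t] ⊆ [0, T)`). One direction stated. [folklore] -/
theorem IsMildNSSolutionOn.congr_ae_Ico {ν T : ℝ} {u w : ℝ → E → E} {u₀ w₀ : E → E}
    (h : IsMildNSSolutionOn (Ico 0 T) ν 0 u₀ u) (hw : ∀ t ∈ Ico 0 T, w t =ᵐ[volume] u t)
    (h₀ : w₀ =ᵐ[volume] u₀) : IsMildNSSolutionOn (Ico 0 T) ν 0 w₀ w := by
  refine ⟨fun t ht => (h.1 t ht).congr_ae (hw t ht).symm, fun t ht φ hφ hφd => ?_⟩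
  have key := h.2 t ht φ hφ hφd
  have e1 : ∫ x, ⟪w t x, φ x⟫ = ∫ x, ⟪u t x, φ x⟫ := by
    refine integral_congr_ae ?_
    filter_upwards [hw t ht] with x hx
    rw [hx]
  have e2 : ∫ x, ⟪w₀ x, heatTest ν φ t x⟫ = ∫ x, ⟪u₀ x, heatTest ν φ t x⟫ := by
    refine integral_congr_ae ?_
    filter_upwards [h₀] with x hx
    rw [hx]
  have e3 : (∫ τ in 0..t, ∫ x, ⟪w τ x, convect (w τ) (heatTest ν φ (t - τ)) x⟫) =
      ∫ τ in 0..t, ∫ x, ⟪u τ x, convect (u τ) (heatTest ν φ (t - τ)) x⟫ := by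
    refine intervalIntegral.integral_congr fun τ hτ => ?_
    rw [uIcc_of_le ht.1] at hτ
    have hτ' : τ ∈ Ico 0 T := ⟨hτ.1, hτ.2.trans_lt ht.2⟩
    refine integral_congr_ae ?_
    filter_upwards [hw τ hτ'] with x hx
    simp only [convect_apply, hx]
  rw [e1, e2, e3]
  exact key

end Congr

/-! ### The bounded representative -/

section Representative

variable {E : Type*} [NormedAddCommGroup E] [InnerProductSpace ℝ E] [FiniteDimensional ℝ E]
  [MeasurableSpace E] [BorelSpace E]

/-- **Bounded representative of an essentially bounded family.** If `‖u t‖_{L^∞} ≤ M` for every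
`t ∈ [0, T)` (`0 < M < ∞`), then the retracted field `w t x = (M / max M ‖u t x‖) • u t x`
satisfies `w t = u t` a.e. for every `t ∈ [0, T)`, `‖w t x‖ ≤ M` everywhere, and inherits the
slice and joint measurability of `u` (the retraction is continuous). [folklore] -/
theorem exists_bounded_representative {T : ℝ} {u : ℝ → E → E} {M : ℝ} (hM : 0 < M)
    (hu : ∀ t ∈ Ico 0 T, eLpNorm (u t) ∞ volume ≤ ENNReal.ofReal M)
    (hsl : ∀ t ∈ Ico 0 T, AEStronglyMeasurable (u t) volume)
    (hmeas : AEStronglyMeasurable (uncurry u) ((volume : Measure (ℝ × E)).restrict (Ioo 0 T ×ˢ univ))) :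
    ∃ w : ℝ → E → E, (∀ t ∈ Ico 0 T, w t =ᵐ[volume] u t) ∧ (∀ t x, ‖w t x‖ ≤ M) ∧
      (∀ t ∈ Ico 0 T, AEStronglyMeasurable (w t) volume) ∧
      AEStronglyMeasurable (uncurry w) ((volume : Measure (ℝ × E)).restrict (Ioo 0 T ×ˢ univ)) := by
  set ρ : E → E := fun v => (M / max M ‖v‖) • v with hρ
  have hρc : Continuous ρ := continuous_radialRetract hM
  refine ⟨fun t x => ρ (u t x), fun t ht => ?_, fun t x => norm_radialRetract_le hM _,
    fun t ht => hρc.comp_aestronglyMeasurable (hsl t ht), hρc.comp_aestronglyMeasurable hmeas⟩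
  have hae : ∀ᵐ x ∂(volume : Measure E), ‖u t x‖ₑ ≤ ENNReal.ofReal M :=
    (ae_le_eLpNormEssSup (f := u t)).mono fun x hx =>
      hx.trans (by rw [← eLpNorm_exponent_top]; exact hu t ht)
  filter_upwards [hae] with x hx
  have hx' : ‖u t x‖ ≤ M := by
    rw [← ofReal_norm] at hx
    exact (ENNReal.ofReal_le_ofReal_iff hM.le).1 hx
  exact radialRetract_eq_self hM hx'

/-- **Essentially bounded mild solutions have bounded weak representatives.** Let `u` be an
unforced duality-form mild solution on `[0, T)` from its initial slice (`0 < ν`, `0 < T`), with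
slices essentially bounded uniformly on `[0, T)` (`‖u t‖_{L^∞} ≤ C < ∞`), measurable slices, and
jointly a.e. strongly measurable on `(0, T) × E`. Then there is a field `w` with `w t = u t` a.e.
for every `t ∈ [0, T)` which is a bounded weak solution on `ℝⁿ × (0, T)` in the sense of KNSS 2009,
§4 (ii) (`IsBoundedWeakNSSolutionOn`): the bounded representative of `exists_bounded_representative`
is again a mild solution from its own initial slice (`IsMildNSSolutionOn.congr_ae_Ico`), and
`isBoundedWeakNSSolutionOn_of_isMildNSSolutionOn` applies to it. [cite: KochNadirashviliSereginSverak2009, §4 (i)–(ii) (arXiv:0709.3599 p. 8)] -/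
theorem exists_isBoundedWeakNSSolutionOn_of_isMildNSSolutionOn {ν T : ℝ} {u : ℝ → E → E}
    (hν : 0 < ν) (hT : 0 < T) (hu : IsMildNSSolutionOn (Ico 0 T) ν 0 (u 0) u) {C : ℝ≥0∞}
    (hC : C < ∞) (hb : ∀ t ∈ Ico 0 T, eLpNorm (u t) ∞ volume ≤ C)
    (hsl : ∀ t ∈ Ico 0 T, AEStronglyMeasurable (u t) volume)
    (hmeas : AEStronglyMeasurable (uncurry u) ((volume : Measure (ℝ × E)).restrict (Ioo 0 T ×ˢ univ))) :
    ∃ w : ℝ → E → E, (∀ t ∈ Ico 0 T, w t =ᵐ[volume] u t) ∧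
      IsBoundedWeakNSSolutionOn (Ioo 0 T) isOpen_Ioo ν w := by
  set M : ℝ := C.toReal + 1 with hMdef
  have hM : 0 < M := by positivity
  have hCM : C ≤ ENNReal.ofReal M := by
    rw [hMdef]
    calc C = ENNReal.ofReal C.toReal := (ENNReal.ofReal_toReal hC.ne).symm
      _ ≤ ENNReal.ofReal (C.toReal + 1) := ENNReal.ofReal_le_ofReal (by linarith)
  obtain ⟨w, hwu, hwM, hwsl, hwmeas⟩ := exists_bounded_representative hM
    (fun t ht => (hb t ht).trans hCM) hsl hmeas
  have h0 : (0 : ℝ) ∈ Ico 0 T := ⟨le_rfl, hT⟩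
  have hw : IsMildNSSolutionOn (Ico 0 T) ν 0 (w 0) w := hu.congr_ae_Ico hwu (hwu 0 h0)
  exact ⟨w, hwu, isBoundedWeakNSSolutionOn_of_isMildNSSolutionOn hν hT hw
    (fun t _ x => hwM t x) hwsl hwmeas⟩

end Representative

end Literature.Analysis.FluidPDE

end
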